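import Mathlib
import HarnessLib.Audit
import Summits.PneNP.PneNP.Theorems.PstarChordReadTwoClean
import Summits.PneNP.PneNP.Theorems.PstarSliceGenericInternal

/-!
# Exact-menu slice genericity: the clean two-chord tools need genericity against FOUR monomial sets only (ROUND-24, O1; memo g24 §34)

FRONTIER range-avoidance ladder, rung F-N3, ROUND 24 (cell `pnp-ideate`, prover-2 memo `g24/O1-NOFREEVERTEX-g24.md` §34; typed target
`PstarCoreBoundTargets.TerminalPeelable` / `TerminalFive` (p646951); restricted-model proof complexity — nothing here bears on `P` versus `NP`).

`PstarChordReadLemma.SliceGeneric I y J₀ c 𝒢` quantifies over every reader whose monomial set is ANY subset of the menu `𝒢`; the census of the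
planner (p3, K27/K28) correspondingly takes the worst case over sub-menus — and saturates at large `k` (p3's family `J₀(m)`, STATUS 2026-08-29
05:17Z).  But the clean two-chord theorem (`PstarChordReadTwoClean.false_of_two_clean`) applies genericity only to readers whose monomial set is
EXACTLY one of: `∅` (`exists_two_slices`), or the fibre restriction `restrictL Γ_α (fibreList (outside J₀) w)` of a channel `α ∈ {Γ₁, Γ₂, Γ₁ ⊕ Γ₂}`,
whose monomial set is the INTERNAL part of `G_α` — the same three sets for every chord and every fibre (`restrictL_fibre_snd`).  This file
re-threads the tools of `PstarChordReadLemma` / `PstarChordReadFibre` / `PstarChordReadTwoClean` through the weaker hypothesis: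

* `SliceGenericExact I y J₀ c G` — genericity against readers `(C, G)` with monomial set exactly `G`; `sliceGenericExact_of_sliceGeneric`,
  `sliceGeneric_empty_iff`;
* `restrictL_fibre_snd` — `(restrictL Γ (fibreList (outside J₀) w)).2 = internalMenu I J₀ G`;
* `chordLocal_of_fail_slice_exact`, `chordLocal_restrictL_of_fail_exact`, `local₂_of_dir10_exact`, `local₁_of_dir01_exact`,
  `local₁₂_of_dir11_exact`, `upgrade_exact` — verbatim re-proofs with the exact hypothesis.

The assembled theorem `false_of_two_clean_exact` (hypothesis `MenuGeneric`: exact genericity for `∅`, `internalMenu G₁`, `internalMenu G₂`,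
`internalMenu (G₁ ∆ G₂)`) is in `PstarTwoCleanExact`.  Consequence for the census: the adversary commits the two menus once, and a certificate
against a chord must carry a WHOLE channel menu in its second reader (`PairCore.normalForm` returns `d₂.G = G ∪ F₂` exactly).
-/

set_option linter.dupNamespace false -- `Summit.PneNP.PneNP.…`: summit = sub-problem name (D-0017 single-conjunct layout)

open Finset Literature.Computability.Complexity
open scoped symmDiff
open Summit.PneNP.PneNP.Theorems.PstarTyped (Typed)
open Summit.PneNP.PneNP.Theorems.PstarSALevel (varSet bdry BoundaryExpanding SimpleOverlap)
open Summit.PneNP.PneNP.Theorems.PstarCentreFree (vars_mem_varSet)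
open Summit.PneNP.PneNP.Theorems.PstarGapOneAll (gval)
open Summit.PneNP.PneNP.Theorems.PstarChordRepair (IsChord)
open Summit.PneNP.PneNP.Theorems.PstarCoreBoundTargets (Terminal)
open Summit.PneNP.PneNP.Theorems.PstarGSat (gSat)
open Summit.PneNP.PneNP.Theorems.PstarFreshErase (slots_ne)
open Summit.PneNP.PneNP.Theorems.PstarChordReadsMirror (gval_eq_split gval_update_pq solves_set_privates)
open Summit.PneNP.PneNP.Theorems.PstarChordReadLemma (ChordLocal SliceGeneric)
open Summit.PneNP.PneNP.Theorems.PstarChordReadFlip (mv)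
open Summit.PneNP.PneNP.Theorems.PstarChordReadOutside (OutsideGated exists_gate_of_slot)
open Summit.PneNP.PneNP.Theorems.PstarChordReadRestrictVar (avoid mem_avoid restrict1 restrictL constL overrideL gval_restrictL restrictL_snd_subset
  overrideL_eq_self)
open Summit.PneNP.PneNP.Theorems.PstarChordReadNor (fibreList mem_fibreList overrideL_fibreList_of_mem overrideL_fibreList_of_not_mem
  overrideL_fibreList_self solves_overrideL_fibreList)
open Summit.PneNP.PneNP.Theorems.PstarChordReadHubLocal (fail₂_of_dir10 fail₁_of_dir01 failSum_of_dir11)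
open Summit.PneNP.PneNP.Theorems.PstarChordReadFibre (outside mem_outside not_mem_outside_of_mem restrictL_snd_avoid mv_eq_of_fibre
  symmDiff_subset_union')
open Summit.PneNP.PneNP.Theorems.PstarChordReadTwoClean (xor_eq_of_solves)
open Summit.PneNP.PneNP.Theorems.PstarSliceGenericInternal (internalMenu mem_internalMenu internalMenu_subset)

namespace Summit.PneNP.PneNP.Theorems.PstarSliceGenericExact

variable {n m : ℕ}

/-- **EXACT-MENU SLICE GENERICITY of the chord `c` for the monomial set `G`**: every reader `(C, G)` with monomial set exactly `G` and
`p, q ∉ C` that misses a value on a whole slice `Sol(J₀ ∖ c) ∩ {x_a ⊕ x_b = t}` is a function of `x_a ⊕ x_b`. -/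
def SliceGenericExact (I : LocalMap 4 n m) (y : Fin m → Bool) (J₀ : Finset (Fin m)) (c : Fin m) (G : Finset (Fin m)) : Prop :=
  ∀ (C : Finset (Fin n)) (t b : Bool), I.vars c 2 ∉ C → I.vars c 3 ∉ C →
    (∀ x : Fin n → Bool, (∀ j ∈ J₀.erase c, I.eval x j = y j) → xor (x (I.vars c 0)) (x (I.vars c 1)) = t → gval I C G x ≠ b) →
    ∃ φ : Bool → Bool, ∀ x : Fin n → Bool, gval I C G x = φ (xor (x (I.vars c 0)) (x (I.vars c 1)))

variable {I : LocalMap 4 n m} {r : ℕ} {y : Fin m → Bool} {J₀ : Finset (Fin m)} {c : Fin m}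

/-- Menu genericity gives exact genericity for every sub-menu. -/
theorem sliceGenericExact_of_sliceGeneric {𝒢 G : Finset (Fin m)} (h : SliceGeneric I y J₀ c 𝒢) (hG : G ⊆ 𝒢) : SliceGenericExact I y J₀ c G :=
  fun C t b hp hq hfail => h C G t b hp hq hG hfail

/-- Menu genericity is exact genericity for all sub-menus. -/
theorem sliceGeneric_iff_exact {𝒢 : Finset (Fin m)} : SliceGeneric I y J₀ c 𝒢 ↔ ∀ G ⊆ 𝒢, SliceGenericExact I y J₀ c G :=
  ⟨fun h _ hG => sliceGenericExact_of_sliceGeneric h hG, fun h C G t b hp hq hG hfail => h G hG C t b hp hq hfail⟩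

/-- For the EMPTY menu the two notions coincide. -/
theorem sliceGeneric_empty_iff : SliceGeneric I y J₀ c ∅ ↔ SliceGenericExact I y J₀ c ∅ := by
  rw [sliceGeneric_iff_exact]
  exact ⟨fun h => h ∅ (Subset.refl _), fun h G hG => by rw [subset_empty.1 hG]; exact h⟩

/-! ## The monomials of a fibre restriction are the internal menu -/

/-- Membership in the monomial part of a multiple restriction: the monomials of `G` avoiding every restricted variable. -/
theorem mem_restrictL_snd_iff (C : Finset (Fin n)) (G : Finset (Fin m)) :
    ∀ (L : List (Fin n × Bool)) (g : Fin m), g ∈ (restrictL I C G L).2 ↔ g ∈ G ∧ ∀ p ∈ L, I.vars g 2 ≠ p.1 ∧ I.vars g 3 ≠ p.1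
  | [], g => by simp [restrictL]
  | q :: L, g => by
    have e : (restrictL I C G (q :: L)).2 = avoid I (restrictL I C G L).2 q.1 := by
      show (restrict1 I (restrictL I C G L).1 (restrictL I C G L).2 q.1 q.2).2 = _
      cases q.2 <;> rfl
    rw [e, mem_avoid, mem_restrictL_snd_iff C G L g]
    constructor
    · rintro ⟨⟨hg, hL⟩, h2, h3⟩
      exact ⟨hg, fun p hp => by
        rcases List.mem_cons.1 hp with rfl | hp
        · exact ⟨h2, h3⟩
        · exact hL p hp⟩
    · rintro ⟨hg, hL⟩
      exact ⟨⟨hg, fun p hp => hL p (List.mem_cons_of_mem _ hp)⟩, (hL q List.mem_cons_self).1, (hL q List.mem_cons_self).2⟩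

/-- **The monomials of a FIBRE restriction are exactly the internal menu** (independent of the linear part and of the fibre). -/
theorem restrictL_fibre_snd (C : Finset (Fin n)) (G : Finset (Fin m)) (w : Fin n → Bool) :
    (restrictL I C G (fibreList (outside I J₀) w)).2 = internalMenu I J₀ G := by
  ext g
  rw [mem_restrictL_snd_iff, mem_internalMenu]
  constructor
  · rintro ⟨hg, hL⟩
    refine ⟨hg, fun h2 => ?_, fun h3 => ?_⟩
    · exact (hL (I.vars g 2, w (I.vars g 2)) (mem_fibreList.2 ⟨h2, rfl⟩)).1 rfl
    · exact (hL (I.vars g 3, w (I.vars g 3)) (mem_fibreList.2 ⟨h3, rfl⟩)).2 rfl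
  · rintro ⟨hg, h2, h3⟩
    refine ⟨hg, fun p hp => ⟨fun e => h2 ?_, fun e => h3 ?_⟩⟩
    · rw [e]; exact (mem_fibreList.1 hp).1
    · rw [e]; exact (mem_fibreList.1 hp).1

/-! ## The slice lemma and the restricted slice lemma, exact form -/
section Slice

variable {𝒢 : Finset (Fin m)}

/-- **SLICE LEMMA (exact menu).**  A reader `(C, G)` (monomials avoiding the privates of `c`) that fails on the slice
`Sol(J₀) ∩ {x_p = π, x_q = κ}` is chord-local, given exact genericity of `c` for `G`.  (`PstarChordReadLemma.chordLocal_of_fail_slice`, re-threaded.) -/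
theorem chordLocal_of_fail_slice_exact (hI : I.IsPure xorAndPred) (hc : c ∈ J₀) (hch : IsChord I J₀ c) {C : Finset (Fin n)} {G : Finset (Fin m)}
    (hgen : SliceGenericExact I y J₀ c G)
    (hmonoG : ∀ g ∈ G, (I.vars g 2 ≠ I.vars c 2 ∧ I.vars g 3 ≠ I.vars c 2) ∧ (I.vars g 2 ≠ I.vars c 3 ∧ I.vars g 3 ≠ I.vars c 3))
    (π κ b : Bool)
    (hfail : ∀ x : Fin n → Bool, (∀ j ∈ J₀, I.eval x j = y j) → x (I.vars c 2) = π → x (I.vars c 3) = κ → gval I C G x ≠ b) :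
    ChordLocal I c C G := by
  classical
  have hpp : (I.vars c 2 = I.vars c 2 ∧ I.vars c 3 = I.vars c 3) ∨ (I.vars c 2 = I.vars c 3 ∧ I.vars c 3 = I.vars c 2) := Or.inl ⟨rfl, rfl⟩
  obtain ⟨-, h0p, h0q, h1p, h1q⟩ := slots_ne hI hpp
  have h23 : I.vars c 2 ≠ I.vars c 3 := fun h => absurd (hI.2 c h) (by decide)
  have hp' : I.vars c 2 ∉ (C.erase (I.vars c 2)).erase (I.vars c 3) := fun h => notMem_erase _ _ (mem_of_mem_erase h)
  have hq' : I.vars c 3 ∉ (C.erase (I.vars c 2)).erase (I.vars c 3) := notMem_erase _ _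
  have hfail' : ∀ x : Fin n → Bool, (∀ j ∈ J₀.erase c, I.eval x j = y j) →
      xor (x (I.vars c 0)) (x (I.vars c 1)) = xor (y c) (π && κ) →
      gval I ((C.erase (I.vars c 2)).erase (I.vars c 3)) G x ≠ xor (xor b (decide (I.vars c 2 ∈ C) && π)) (decide (I.vars c 3 ∈ C) && κ) := by
    intro x hx hab hval
    have hab' : xor (xor (x (I.vars c 0)) (x (I.vars c 1))) (π && κ) = y c := by
      rw [hab]; cases y c <;> cases (π && κ) <;> rfl
    have hsol := solves_set_privates hI hc hch hx π κ hab'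
    have hπ : Function.update (Function.update x (I.vars c 2) π) (I.vars c 3) κ (I.vars c 2) = π := by
      rw [Function.update_of_ne h23, Function.update_self]
    have hκ : Function.update (Function.update x (I.vars c 2) π) (I.vars c 3) κ (I.vars c 3) = κ := Function.update_self ..
    refine hfail _ hsol hπ hκ ?_
    rw [gval_eq_split I h23 C G, gval_update_pq I hp' hq' hmonoG x π κ, hval, hπ, hκ]
    cases b <;> cases (decide (I.vars c 2 ∈ C) && π) <;> cases (decide (I.vars c 3 ∈ C) && κ) <;> rfl
  obtain ⟨φ, hφ⟩ := hgen _ _ _ hp' hq' hfail'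
  refine ⟨fun s u v => xor (xor (φ s) (decide (I.vars c 2 ∈ C) && u)) (decide (I.vars c 3 ∈ C) && v), fun x => ?_⟩
  rw [gval_eq_split I h23 C G x, hφ x]

/-- **RESTRICTED SLICE LEMMA (exact menu).**  `c` an outside-gated chord for the menu `𝒢`, exactly generic for the internal menu of `G ⊆ 𝒢`; a
reader `(C, G)` missing `β` at every solution of the core on the private slice `(π, κ)` of `c` inside the fibre of `w`.  Then `Γ|_w` is
chord-local at `c`.  (`PstarChordReadFibre.chordLocal_restrictL_of_fail`, re-threaded.) -/
theorem chordLocal_restrictL_of_fail_exact (hI : I.IsPure xorAndPred) (hS : SimpleOverlap I) (hc : c ∈ J₀) (hch : IsChord I J₀ c)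
    (hO : OutsideGated I J₀ 𝒢 c) {C : Finset (Fin n)} {G : Finset (Fin m)} (hG : G ⊆ 𝒢)
    (hgen : SliceGenericExact I y J₀ c (internalMenu I J₀ G)) (w : Fin n → Bool) (π κ β : Bool)
    (hfail : ∀ x : Fin n → Bool, (∀ j ∈ J₀, I.eval x j = y j) → x (I.vars c 2) = π → x (I.vars c 3) = κ →
      (∀ z ∈ outside I J₀, x z = w z) → gval I C G x ≠ β) :
    ChordLocal I c (restrictL I C G (fibreList (outside I J₀) w)).1 (restrictL I C G (fibreList (outside I J₀) w)).2 := by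
  classical
  set Z := outside I J₀ with hZ
  set L := fibreList Z w with hL
  set R := restrictL I C G L with hR
  have hZout : ∀ z ∈ Z, ∀ j ∈ J₀, z ∉ varSet I j := fun z hz => (mem_outside I).1 hz
  have hR₂ : R.2 ⊆ G := restrictL_snd_subset I C G L
  have hR₂e : R.2 = internalMenu I J₀ G := restrictL_fibre_snd C G w
  have hp : I.vars c 2 ∉ Z := not_mem_outside_of_mem I hc (vars_mem_varSet I c 2)
  have hq : I.vars c 3 ∉ Z := not_mem_outside_of_mem I hc (vars_mem_varSet I c 3)
  have avoids : ∀ g ∈ R.2, ∀ {v : Fin n}, (v = I.vars c 2 ∨ v = I.vars c 3) → I.vars g 2 ≠ v ∧ I.vars g 3 ≠ v := by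
    intro g hg v hv
    by_contra hne
    have hgv : I.vars g 2 = v ∨ I.vars g 3 = v := by
      by_contra h'; push Not at h'; exact hne h'
    obtain ⟨z, hGate⟩ := exists_gate_of_slot hO hc (hG (hR₂ hg)) hv hgv
    have hzZ : z ∈ Z := (mem_outside I).2 hGate.2.2
    have hav := restrictL_snd_avoid I C G L g hg (z, w z) (mem_fibreList.2 ⟨hzZ, rfl⟩)
    rcases hGate.2.1 with ⟨-, h3⟩ | ⟨h2, -⟩
    · exact hav.2 h3
    · exact hav.1 h2
  have hmono : ∀ g ∈ R.2, (I.vars g 2 ≠ I.vars c 2 ∧ I.vars g 3 ≠ I.vars c 2) ∧ (I.vars g 2 ≠ I.vars c 3 ∧ I.vars g 3 ≠ I.vars c 3) :=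
    fun g hg => ⟨avoids g hg (Or.inl rfl), avoids g hg (Or.inr rfl)⟩
  have hgenR : SliceGenericExact I y J₀ c R.2 := by rw [hR₂e]; exact hgen
  refine chordLocal_of_fail_slice_exact hI hc hch hgenR hmono π κ (xor β (constL I C G L)) fun x hx hxp hxq h => ?_
  rw [hR, gval_restrictL I hI hS] at h
  have hs := solves_overrideL_fibreList I hZout w hx
  have hne := hfail (overrideL x L) hs (by rw [hL, overrideL_fibreList_of_not_mem w x hp]; exact hxp)
    (by rw [hL, overrideL_fibreList_of_not_mem w x hq]; exact hxq) (fun z hz => by rw [hL, overrideL_fibreList_of_mem w x hz])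
  revert h hne
  cases gval I C G (overrideL x L) <;> cases β <;> cases constL I C G L <;> decide

end Slice

/-! ## Free lunch on a fibre, exact form -/
section FreeLunch

variable {w₁ w₂ : Finset (Fin n) × Finset (Fin m) × Bool} {v v' : Fin n}

/-- **Direction `(1,0)` at `w` ⟹ `Γ₂|_w` is chord-local at `c`** (exact genericity for the internal menu of `G₂`). -/
theorem local₂_of_dir10_exact (hI : I.IsPure xorAndPred) (hS : SimpleOverlap I) (ht : Terminal I r y J₀ w₁ w₂) (hc : c ∈ J₀)
    (hch : IsChord I J₀ c) (hO : OutsideGated I J₀ (w₁.2.1 ∪ w₂.2.1) c) (hgen : SliceGenericExact I y J₀ c (internalMenu I J₀ w₂.2.1))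
    (hvv : (I.vars c 2 = v ∧ I.vars c 3 = v') ∨ (I.vars c 2 = v' ∧ I.vars c 3 = v)) (w : Fin n → Bool)
    (h₁ : mv I w₁.1 w₁.2.1 v w = true) (h₂ : mv I w₂.1 w₂.2.1 v w = false) :
    ChordLocal I c (restrictL I w₂.1 w₂.2.1 (fibreList (outside I J₀) w)).1 (restrictL I w₂.1 w₂.2.1 (fibreList (outside I J₀) w)).2 := by
  have hv : v = I.vars c 2 ∨ v = I.vars c 3 := by
    rcases hvv with ⟨h, -⟩ | ⟨-, h⟩
    exacts [Or.inl h.symm, Or.inr h.symm]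
  refine chordLocal_restrictL_of_fail_exact hI hS hc hch hO subset_union_right hgen w false false w₂.2.2 fun x hx hxp hxq hz => ?_
  have h0 : x v' = false := by
    rcases hvv with ⟨-, h⟩ | ⟨h, -⟩
    · rw [← h]; exact hxq
    · rw [← h]; exact hxp
  exact fail₂_of_dir10 hI ht hc hch hvv hx h0 (by rw [mv_eq_of_fibre hI hS hO hc subset_union_left hv hz]; exact h₁)
    (by rw [mv_eq_of_fibre hI hS hO hc subset_union_right hv hz]; exact h₂)

/-- **Direction `(0,1)` at `w` ⟹ `Γ₁|_w` is chord-local at `c`** (exact genericity for the internal menu of `G₁`). -/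
theorem local₁_of_dir01_exact (hI : I.IsPure xorAndPred) (hS : SimpleOverlap I) (ht : Terminal I r y J₀ w₁ w₂) (hc : c ∈ J₀)
    (hch : IsChord I J₀ c) (hO : OutsideGated I J₀ (w₁.2.1 ∪ w₂.2.1) c) (hgen : SliceGenericExact I y J₀ c (internalMenu I J₀ w₁.2.1))
    (hvv : (I.vars c 2 = v ∧ I.vars c 3 = v') ∨ (I.vars c 2 = v' ∧ I.vars c 3 = v)) (w : Fin n → Bool)
    (h₁ : mv I w₁.1 w₁.2.1 v w = false) (h₂ : mv I w₂.1 w₂.2.1 v w = true) :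
    ChordLocal I c (restrictL I w₁.1 w₁.2.1 (fibreList (outside I J₀) w)).1 (restrictL I w₁.1 w₁.2.1 (fibreList (outside I J₀) w)).2 := by
  have hv : v = I.vars c 2 ∨ v = I.vars c 3 := by
    rcases hvv with ⟨h, -⟩ | ⟨-, h⟩
    exacts [Or.inl h.symm, Or.inr h.symm]
  refine chordLocal_restrictL_of_fail_exact hI hS hc hch hO subset_union_left hgen w false false w₁.2.2 fun x hx hxp hxq hz => ?_
  have h0 : x v' = false := by
    rcases hvv with ⟨-, h⟩ | ⟨h, -⟩
    · rw [← h]; exact hxq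
    · rw [← h]; exact hxp
  exact fail₁_of_dir01 hI ht hc hch hvv hx h0 (by rw [mv_eq_of_fibre hI hS hO hc subset_union_left hv hz]; exact h₁)
    (by rw [mv_eq_of_fibre hI hS hO hc subset_union_right hv hz]; exact h₂)

/-- **Direction `(1,1)` at `w` ⟹ `(Γ₁ ⊕ Γ₂)|_w` is chord-local at `c`** (exact genericity for the internal menu of `G₁ ∆ G₂`). -/
theorem local₁₂_of_dir11_exact (hI : I.IsPure xorAndPred) (hS : SimpleOverlap I) (ht : Terminal I r y J₀ w₁ w₂) (hc : c ∈ J₀)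
    (hch : IsChord I J₀ c) (hO : OutsideGated I J₀ (w₁.2.1 ∪ w₂.2.1) c)
    (hgen : SliceGenericExact I y J₀ c (internalMenu I J₀ (w₁.2.1 ∆ w₂.2.1)))
    (hvv : (I.vars c 2 = v ∧ I.vars c 3 = v') ∨ (I.vars c 2 = v' ∧ I.vars c 3 = v)) (w : Fin n → Bool)
    (h₁ : mv I w₁.1 w₁.2.1 v w = true) (h₂ : mv I w₂.1 w₂.2.1 v w = true) :
    ChordLocal I c (restrictL I (w₁.1 ∆ w₂.1) (w₁.2.1 ∆ w₂.2.1) (fibreList (outside I J₀) w)).1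
      (restrictL I (w₁.1 ∆ w₂.1) (w₁.2.1 ∆ w₂.2.1) (fibreList (outside I J₀) w)).2 := by
  have hv : v = I.vars c 2 ∨ v = I.vars c 3 := by
    rcases hvv with ⟨h, -⟩ | ⟨-, h⟩
    exacts [Or.inl h.symm, Or.inr h.symm]
  refine chordLocal_restrictL_of_fail_exact hI hS hc hch hO (symmDiff_subset_union' _ _) hgen w false false (xor w₁.2.2 w₂.2.2)
    fun x hx hxp hxq hz => ?_
  have h0 : x v' = false := by
    rcases hvv with ⟨-, h⟩ | ⟨h, -⟩
    · rw [← h]; exact hxq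
    · rw [← h]; exact hxp
  exact failSum_of_dir11 hI ht hc hch hvv hx h0 (by rw [mv_eq_of_fibre hI hS hO hc subset_union_left hv hz]; exact h₁)
    (by rw [mv_eq_of_fibre hI hS hO hc subset_union_right hv hz]; exact h₂)

end FreeLunch

/-! ## Upgrading one local channel, exact form -/
section Upgrade

variable {𝒢 : Finset (Fin m)} {Cα Cβ : Finset (Fin n)} {Gα Gβ : Finset (Fin m)} {βα ββ : Bool}

/-- **UPGRADE (exact menu).**  As `PstarChordReadTwoClean.upgrade`, with exact genericity of `c` for the internal menu of `Gβ`. -/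
theorem upgrade_exact (hI : I.IsPure xorAndPred) (hT : Typed I) (hS : SimpleOverlap I) (hB : BoundaryExpanding r I) (hJr : J₀.card ≤ r)
    (hc : c ∈ J₀) (hch : IsChord I J₀ c) (hO : OutsideGated I J₀ 𝒢 c) (hgen : SliceGenericExact I y J₀ c (internalMenu I J₀ Gβ))
    (hdisj : Disjoint J₀ 𝒢) (hGα : Gα ⊆ 𝒢) (hGβ : Gβ ⊆ 𝒢)
    (hpm : ∀ x : Fin n → Bool, (∀ j ∈ J₀, I.eval x j = y j) → gval I Cα Gα x = βα → gval I Cβ Gβ x ≠ ββ) (w : Fin n → Bool)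
    (hloc : ChordLocal I c (restrictL I Cα Gα (fibreList (outside I J₀) w)).1 (restrictL I Cα Gα (fibreList (outside I J₀) w)).2) :
    (∀ u u' : Fin n → Bool, gval I (restrictL I Cα Gα (fibreList (outside I J₀) w)).1 (restrictL I Cα Gα (fibreList (outside I J₀) w)).2 u =
        gval I (restrictL I Cα Gα (fibreList (outside I J₀) w)).1 (restrictL I Cα Gα (fibreList (outside I J₀) w)).2 u') ∨
      ChordLocal I c (restrictL I Cβ Gβ (fibreList (outside I J₀) w)).1 (restrictL I Cβ Gβ (fibreList (outside I J₀) w)).2 := by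
  classical
  set L := fibreList (outside I J₀) w with hL
  set R := restrictL I Cα Gα L with hR
  obtain ⟨φ, hφ⟩ := hloc
  set target := xor βα (constL I Cα Gα L) with htarget
  have key : ∀ x : Fin n → Bool, (∀ j ∈ J₀, I.eval x j = y j) →
      gval I R.1 R.2 x = φ (xor (y c) (x (I.vars c 2) && x (I.vars c 3))) (x (I.vars c 2)) (x (I.vars c 3)) := by
    intro x hx; rw [hφ x, xor_eq_of_solves hI hc hx]
  by_cases hex : ∃ π κ : Bool, φ (xor (y c) (π && κ)) π κ = target
  · right
    obtain ⟨π, κ, hπκ⟩ := hex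
    refine chordLocal_restrictL_of_fail_exact hI hS hc hch hO hGβ hgen w π κ ββ fun x hx hxp hxq hz => ?_
    have hxL : overrideL x L = x := overrideL_eq_self L x fun p hp => by
      obtain ⟨h1, h2⟩ := mem_fibreList.1 hp
      rw [h2]; exact hz _ h1
    have hα : gval I Cα Gα x = βα := by
      have h := key x hx
      rw [hxp, hxq, hπκ, htarget, hR, gval_restrictL I hI hS, hxL] at h
      revert h; cases gval I Cα Gα x <;> cases βα <;> cases constL I Cα Gα L <;> decide
    exact hpm x hx hα
  · left
    push Not at hex
    by_contra hnc
    push Not at hnc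
    obtain ⟨u, u', huu⟩ := hnc
    obtain ⟨x, hx, hxv⟩ := gSat n m r I hI hT hB hS y J₀ R.2 R.1 target hJr
      (hdisj.mono_right ((restrictL_snd_subset I Cα Gα L).trans hGα)) ⟨u, u', huu⟩
    rw [key x hx] at hxv
    exact hex _ _ hxv

end Upgrade

end Summit.PneNP.PneNP.Theorems.PstarSliceGenericExact
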